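import Literature.AlgebraicGeometry.FormalGeometry.LocallyFreeOfThickenings
import Literature.AlgebraicGeometry.Modules.VectorBundleCokernelFinitePresentation
import HarnessLib

/-!
# Görtz–Wedhorn II, Prop. 24.95 (algebraic half) for cokernels of morphisms of vector bundles over `W(k)`

Görtz–Wedhorn, *Algebraic Geometry II* (2023), proof of Prop. 24.95 with Lemma 24.96 (p. 567): a
coherent `𝒪_X`-module on a proper `A`-scheme (`A` noetherian, `I`-adically complete) whose
restrictions to all the thickenings `X_n` are locally free is locally free (tree
`Literature/AlgebraicGeometry/FormalGeometry/LocallyFreeOfThickenings`, for finitely presented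
modules). This file records the instance of that statement in which the module is the COKERNEL of a
morphism `u : V' → V` of vector bundles on a proper `W(k)`-scheme — finitely presented by
`Modules/VectorBundleCokernelFinitePresentation` (The Stacks Project, Tag 01BP) —, which is the form
in which the algebraization of formal vector bundles over `W(k)` uses Prop. 24.95 once a formal
vector bundle has been written as the completion of `coker u` for algebraic vector bundles `V'`, `V`
(Grothendieck's existence theorem, Thm. 24.94, via twisting presentations):

* `WittScheme.isVectorBundle_cokernel_of_isVectorBundle_thickenings` — for `k` a perfect field of
  characteristic `p`, `Z → Spec W(k)` proper, `u : V' → V` a morphism of vector bundles on `Z` such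
  that `(coker u)|_{Z_{n+1}}` is a vector bundle on every thickening `Z_{n+1} = Z ⊗_W W/pⁿ⁺¹`, the
  cokernel `coker u` is a vector bundle;
* `WittScheme.formallyFreeCokernel` — the same with all binders explicit and outermost (the shape
  `∀ p k Z, IsProper Z.hom → ∀ V V' u, … → IsVectorBundle (cokernel u)`).

Everything is proved; no named facts.

## References

* U. Görtz, T. Wedhorn, *Algebraic Geometry II: Cohomology of Schemes*, Springer Spektrum (2023),
  doi:10.1007/978-3-658-43031-3: Prop. 24.95 and its proof, Lemma 24.96 (pp. 566–567).
  [GortzWedhorn2023]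
* The Stacks Project, Tag 01BP (finite locally free ⇒ finite presentation). [StacksProject]
-/

universe u

open CategoryTheory CategoryTheory.Limits AlgebraicGeometry
open Literature.AlgebraicGeometry.Motives Literature.AlgebraicGeometry.Motives.WittScheme
open Literature.AlgebraicGeometry.Modules

namespace Literature.AlgebraicGeometry.FormalGeometry.WittScheme

/-- **Görtz–Wedhorn II, Prop. 24.95 (algebraic half) for a cokernel of vector bundles over `W(k)`.**
Let `k` be a perfect field of characteristic `p`, `Z → Spec W(k)` proper, and `u : V' → V` a morphism
of vector bundles on `Z`. If the restriction of `coker u` to every thickening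
`Z_{n+1} = Z ⊗_W W/pⁿ⁺¹` is a vector bundle, then `coker u` is a vector bundle (it is finitely
presented, Stacks 01BP, and `LocallyFreeOfThickenings` applies).
[cite: GortzWedhorn2023, Prop 24.95 and its proof, Lemma 24.96 (pp. 566–567)] -/
theorem isVectorBundle_cokernel_of_isVectorBundle_thickenings {p : ℕ} [Fact p.Prime] {k : Type u}
    [Field k] [CharP k p] [PerfectRing k p] (Z : SchemeOver (WittVector p k)) [IsProper Z.hom]
    {V V' : Z.left.Modules} (u : V' ⟶ V) (hV : IsVectorBundle V) (hV' : IsVectorBundle V')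
    (h : ∀ n : ℕ, IsVectorBundle ((Scheme.Modules.pullback (thickeningι Z (n + 1))).obj (cokernel u))) :
    IsVectorBundle (cokernel u) :=
  isVectorBundle_of_isVectorBundle_thickenings Z (cokernel u)
    (isFinitePresentation_cokernel_of_isVectorBundle u hV hV') h

/-- The same statement with all binders explicit: for every prime `p`, perfect field `k` of
characteristic `p` and proper `W(k)`-scheme `Z`, the cokernel of a morphism of vector bundles on
`Z` all of whose restrictions to the thickenings `Z_{n+1}` are vector bundles is a vector bundle.
[cite: GortzWedhorn2023, Prop 24.95 and its proof, Lemma 24.96 (pp. 566–567)] -/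
theorem formallyFreeCokernel :
    ∀ (p : ℕ) [Fact p.Prime] (k : Type u) [Field k] [CharP k p] [PerfectRing k p]
      (Z : SchemeOver (WittVector p k)), IsProper Z.hom →
      ∀ (V V' : Z.left.Modules) (u : V' ⟶ V), IsVectorBundle V → IsVectorBundle V' →
        (∀ n : ℕ, IsVectorBundle
          ((Scheme.Modules.pullback (thickeningι Z (n + 1))).obj (cokernel u))) →
        IsVectorBundle (cokernel u) :=
  fun _ _ _ _ _ _ Z _ _ _ u hV hV' h => isVectorBundle_cokernel_of_isVectorBundle_thickenings Z u hV hV' h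

end Literature.AlgebraicGeometry.FormalGeometry.WittScheme
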